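import Summits.CriticalPhenomena.PercolationContinuityZ3.Theorems.PercNearOneGluingNoHeavyLowerTailTwoLevelPackingCardSubTwoPieces
import Summits.CriticalPhenomena.PercolationContinuityZ3.Theorems.PercNearOneGluingNoHeavyLowerTailSharpTCSReduction
import HarnessLib

/-!
# `NoHeavyLowerTail` (stmt-CriticalPhenomena-4575) — STCS2, THE TWO-LEVEL PACKING QP AND THE QUANTITATIVE GAP QG AT LEVEL `|A| − 2`, for every `|A|`

Support file (lemma factory #8 `prim-lf-8`, gen 5; `--supports stmt-CriticalPhenomena-4575`).  No definitions, no named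
facts, no sorries.  `μ = prodBernoulli w` on `Fin n`, relays `A` (`k = |A| ≥ 3`), observer `o`, level `j = k − 2`,
`R_a = {|π(a)| ≤ k−2}`, `S(a) = μ(R_a)`, `L = {1 ≤ N ≤ k−2}`, `F = {o ↮ c}`.

The QG family of the lemma factory (run/shared/lean/prim/prim-lf-8/QG-FAMILY-ROOT.md; census lf8qg, 0 violations in
1.70e9 multigraphs + 2.86 M weighted champion cases, all cells `j ≤ k − 2`) has the chain TTP ⇒ STCS2 ⇒ **QP ⇒ QG ⇒ CIL**,
typed in `…QuantGapReductions.lean` with the binder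

  **QP_j(c, t)**:  `μ(F ∩ L) · S(c) ≤ μ(F ∩ R_c) · t`   for `0 ≤ t`, `S(a) ≤ t ≤ S(c)` (`a ∈ A ∖ c`).

and its T-class sharpening STCS2 (`…SharpTCSReduction`: right-hand event `F ∩ {1 ≤ N} ∩ R_c`).  Level `j = 1` is a theorem for
every `|A|` (`…SharpTCSOne`, `…CondPackingOne`).  THIS FILE PROVES LEVEL `j = |A| − 2` FOR EVERY `|A| ≥ 3`: STCS2
(`sharpTCS_card_sub_two`), hence QP (`twoLevelPacking_card_sub_two`) and QG (`quantGap_card_sub_two`) — the first members of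
the quantitative family established k-uniformly above level one (the linear members XZ / CIL at level `|A| − 2` are the
lead's `…AttachedChampionCardSubTwo`).

Proof.  At level `k − 2`, `R_x = M ⊔ H_x` with the common FRAGMENTED world `M = {no relay block of size ≥ k−1}` and
`H_x = D_x ∩ Q_x` (`x` isolated, `A ∖ x` joined); `m = μ(M)`, `u_x = μ(H_x)`, `S(x) = m + u_x`.  With `X = μ(F ∩ L ∩ R_c)`,
`G = Σ_{d≠c} μ({o↔d} ∩ H_d)`, `g' = μ(D_c ∩ {o ↔ A∖c} ∩ Q_c)`:  `μ(F ∩ L) ≤ X + G` (cover), `μ(F ∩ {1≤N} ∩ R_c) ≥ X + g'`,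
(T5') `G · u_c ≤ τ · g'` for `u_d ≤ τ` (`…Tools.packingChain_of_pairSep_pos`: KN Lemma 1(ii)+(i), disjointness in the
separated world, set-BHK), (T4) `X · u_c ≤ m · g'` (`…Transfer.fragmented_transfer`: partition by the block of `c`, two
set-exchanges, set-BHK); then with `t = m + τ`:
`u_c·[(X + g')t − (X + G)(m + u_c)] = (u_c − τ)(m g' − X u_c) + (τ g' − G u_c)(m + u_c) ≥ 0`.
The null separation event is removed by scaling the weights (`stub_weightContinuity`), as in `…AttachedChampionCardSubTwo`.
-/

noncomputable section

namespace Summit.CriticalPhenomena.PercolationContinuityZ3.Theorems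

open MeasureTheory Set Filter Literature.Probability.LatticeModels Literature.Probability.Percolation
open scoped Classical BigOperators Topology

namespace TwoLevelPackingCardSubTwo

variable {n : ℕ}

/-- **STCS2 at level `|A| − 2` with a non-null separation event (deficiency form, multiplied by `h(c)`).** -/
theorem stcs_of_pairSep_pos (w : Sym2 (Fin n) → unitInterval) (A : Finset (Fin n)) (o c : Fin n) (t δ : ℝ)
    (ht : 0 ≤ t) (hδ : 0 ≤ δ) (hc : c ∈ A) (hk : 3 ≤ A.card)
    (hdom : ∀ a ∈ A.erase c,
      (prodBernoulli w).real {ω : BondConfig (Fin n) | (A.filter fun x => ω ∈ openConn a x).card ≤ A.card - 2} ≤ t + δ)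
    (htc : t ≤ (prodBernoulli w).real {ω : BondConfig (Fin n) | (A.filter fun x => ω ∈ openConn c x).card ≤ A.card - 2} + δ)
    (hM : 0 < (prodBernoulli w).real
      {ω : Set (Sym2 (Fin n)) | ∀ x ∈ A, ∀ y ∈ A, x ≠ y → ω ∉ openConn x y}) :
    (prodBernoulli w).real ((openConn o c : Set (BondConfig (Fin n)))ᶜ ∩
          {ω | 1 ≤ (A.filter fun x => ω ∈ openConn o x).card ∧
            (A.filter fun x => ω ∈ openConn o x).card ≤ A.card - 2}) *
        (prodBernoulli w).real {ω : BondConfig (Fin n) | (A.filter fun x => ω ∈ openConn c x).card ≤ A.card - 2} *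
        (prodBernoulli w).real ({ω : BondConfig (Fin n) | ∀ t ∈ A.erase c, ω ∉ openConn c t} ∩
          {ω | ∀ t ∈ (↑(A.erase c) : Set (Fin n)), ∀ t' ∈ (↑(A.erase c) : Set (Fin n)), ω ∈ openConn t t'}) ≤
      (prodBernoulli w).real ((openConn o c : Set (BondConfig (Fin n)))ᶜ ∩
          {ω | 1 ≤ (A.filter fun x => ω ∈ openConn o x).card ∧
            (A.filter fun x => ω ∈ openConn c x).card ≤ A.card - 2}) * t *
        (prodBernoulli w).real ({ω : BondConfig (Fin n) | ∀ t ∈ A.erase c, ω ∉ openConn c t} ∩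
          {ω | ∀ t ∈ (↑(A.erase c) : Set (Fin n)), ∀ t' ∈ (↑(A.erase c) : Set (Fin n)), ω ∈ openConn t t'}) + 3 * δ := by
  set μ := prodBernoulli w with hμ
  set F : Set (BondConfig (Fin n)) := (openConn o c : Set (BondConfig (Fin n)))ᶜ with hF
  set L : Set (BondConfig (Fin n)) := {ω | 1 ≤ (A.filter fun x => ω ∈ openConn o x).card ∧
    (A.filter fun x => ω ∈ openConn o x).card ≤ A.card - 2} with hL
  set R : Fin n → Set (BondConfig (Fin n)) := fun a =>
    {ω | (A.filter fun x => ω ∈ openConn a x).card ≤ A.card - 2} with hR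
  set D : Fin n → Set (BondConfig (Fin n)) := fun d => {ω | ∀ t ∈ A.erase d, ω ∉ openConn d t} with hD
  set Qc : Fin n → Set (BondConfig (Fin n)) :=
    fun d => {ω | ∀ t ∈ (↑(A.erase d) : Set (Fin n)), ∀ t' ∈ (↑(A.erase d) : Set (Fin n)), ω ∈ openConn t t'} with hQc
  set U : Set (BondConfig (Fin n)) := ⋃ b ∈ A.erase c, openConn o b with hU
  have hmeas : ∀ s : Set (BondConfig (Fin n)), MeasurableSet s := fun _ => MeasurableSet.of_discrete
  have hnn : ∀ s : Set (BondConfig (Fin n)), 0 ≤ μ.real s := fun _ => measureReal_nonneg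
  have hle1 : ∀ s : Set (BondConfig (Fin n)), μ.real s ≤ 1 := fun _ => measureReal_le_one
  have hmono : ∀ {s s' : Set (BondConfig (Fin n))}, s ⊆ s' → μ.real s ≤ μ.real s' :=
    fun hst => measureReal_mono hst (measure_ne_top μ _)
  -- a second relay
  have hne : (A.erase c).Nonempty := by
    rw [← Finset.card_pos, Finset.card_erase_of_mem hc]; omega
  obtain ⟨d₀, hd₀⟩ := hne
  have hd₀A : d₀ ∈ A := Finset.mem_of_mem_erase hd₀
  have hd₀c : d₀ ≠ c := (Finset.mem_erase.1 hd₀).1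
  -- quantities
  set X := μ.real (F ∩ L ∩ R c) with hX
  set G := ∑ d ∈ A.erase c, μ.real (openConn o d ∩ D d ∩ Qc d) with hG
  set Sc := μ.real (R c) with hSc
  set u := μ.real (D c ∩ Qc c) with hu
  set g' := μ.real (D c ∩ (U ∩ Qc c)) with hg'
  set V := μ.real (F ∩ {ω | 1 ≤ (A.filter fun x => ω ∈ openConn o x).card ∧
    (A.filter fun x => ω ∈ openConn c x).card ≤ A.card - 2}) with hV
  -- `H_c = R_c ∖ R_{d₀}`, so `H_c ⊆ R_c` and `m = μ(R_c ∖ H_c) = S_c − u`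
  have hHsub : D c ∩ Qc c ⊆ R c := by
    rw [← AttachedChampionCardSubTwo.sdiff_eq_partition A hd₀A hc hd₀c hk]; exact fun _ hω => hω.1
  have hm : μ.real (R c \ (D c ∩ Qc c)) = Sc - u := by
    have h := measureReal_inter_add_sdiff (μ := μ) (s := R c) (t := D c ∩ Qc c) (hmeas _)
    rw [Set.inter_eq_right.2 hHsub] at h
    rw [hSc, hu]; linarith
  set m := Sc - u with hm_def
  have hm0 : 0 ≤ m := by rw [← hm]; exact hnn _
  -- for `d ≠ c`: `S(d) = m + u_d`
  have hSd : ∀ d ∈ A.erase c, μ.real (R d) = m + μ.real (D d ∩ Qc d) := by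
    intro d hd
    have h := light_split w A c hc hk hd
    change μ.real (R d) = Sc - u + μ.real (D d ∩ Qc d) at h
    rw [h]
  -- `τ = t + δ − m ≥ 0` dominates every `u_d`, `d ≠ c`
  set τ := t + δ - m with hτ_def
  have hud : ∀ d ∈ A.erase c, μ.real (D d ∩ Qc d) ≤ τ := by
    intro d hd
    have := hdom d hd
    rw [hSd d hd] at this
    rw [hτ_def]; linarith
  have hτ0 : 0 ≤ τ := (hnn _).trans (hud d₀ hd₀)
  -- (T5') packing chain and (T4) fragmented transfer
  have hT5 : G * u ≤ τ * g' := packingChain_of_pairSep_pos w A o c τ hτ0 hc hud hM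
  have hT4 : X * u ≤ m * g' := by rw [← hm]; exact fragmented_transfer w A o c hc hk
  -- cover and lower piece
  have hcover : μ.real (F ∩ L) ≤ X + G := cover_le w A o c hc
  have hlow : X + g' ≤ V := lower_piece_le w A o c hc hk
  -- bounds
  have hX0 : 0 ≤ X := hnn _
  have hG0 : 0 ≤ G := Finset.sum_nonneg fun _ _ => hnn _
  have hu0 : 0 ≤ u := hnn _
  have hg0 : 0 ≤ g' := hnn _
  have hV0 : 0 ≤ V := hnn _
  have hSc1 : Sc ≤ 1 := hle1 _
  have hg1 : g' ≤ 1 := hle1 _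
  have hmSc : m + u = Sc := by rw [hm_def]; ring
  have hτu : τ ≤ u + 2 * δ := by
    have : t ≤ Sc + δ := htc
    rw [hτ_def, hm_def]; linarith
  -- the algebra: `u (X + G)(m + u) ≤ u V t + 2δ`
  have hmu0 : 0 ≤ m + u := by linarith
  have ht_eq : t = τ + m - δ := by rw [hτ_def]; ring
  have hVt : (X + g') * t * u ≤ V * t * u :=
    mul_le_mul_of_nonneg_right (mul_le_mul_of_nonneg_right hlow ht) hu0
  have hGu : G * u * (m + u) ≤ τ * g' * (m + u) := mul_le_mul_of_nonneg_right hT5 hmu0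
  -- `δ u (X + g') ≤ δ`
  have hXg1 : X + g' ≤ 1 := hlow.trans (hle1 _)
  have hu1 : u ≤ 1 := hle1 _
  have hE1 : δ * (u * (X + g')) ≤ δ := by
    have h : u * (X + g') ≤ 1 := by
      calc u * (X + g') ≤ 1 * 1 := mul_le_mul hu1 hXg1 (by linarith) zero_le_one
        _ = 1 := one_mul 1
    calc δ * (u * (X + g')) ≤ δ * 1 := mul_le_mul_of_nonneg_left h hδ
      _ = δ := mul_one δ
  -- `(u − τ)(g' m − X u) ≥ −δ`
  have hm1 : m ≤ 1 := by have := hle1 (R c \ (D c ∩ Qc c)); rw [hm] at this; exact this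
  have hgm1 : g' * m ≤ 1 := by
    calc g' * m ≤ 1 * 1 := mul_le_mul hg1 hm1 hm0 zero_le_one
      _ = 1 := one_mul 1
  have hE2 : -(2 * δ) ≤ (u - τ) * (g' * m - X * u) := by
    by_cases hsg : τ ≤ u
    · have h1 : 0 ≤ (u - τ) * (g' * m - X * u) := mul_nonneg (by linarith) (by linarith)
      linarith
    · rw [not_le] at hsg
      have hXu0 : 0 ≤ X * u := mul_nonneg hX0 hu0
      have h1 : (τ - u) * (g' * m - X * u) ≤ (τ - u) * (g' * m) :=
        mul_le_mul_of_nonneg_left (by linarith) (by linarith)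
      have h2 : (τ - u) * (g' * m) ≤ (2 * δ) * 1 :=
        mul_le_mul (by linarith) hgm1 (mul_nonneg hg0 hm0) (by linarith)
      have h3 : (u - τ) * (g' * m - X * u) = -((τ - u) * (g' * m - X * u)) := by ring
      rw [h3]; linarith
  -- the identity `(X+g') t u − X (m+u) u − τ g' (m+u) = (u − τ)(g' m − X u) − δ u (X + g')`
  have hid : (X + g') * t * u - X * (m + u) * u - τ * g' * (m + u) =
      (u - τ) * (g' * m - X * u) - δ * (u * (X + g')) := by rw [ht_eq]; ring
  have key : (X + G) * Sc * u ≤ V * t * u + 3 * δ := by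
    rw [← hmSc]
    have h1 : (X + G) * (m + u) * u = X * (m + u) * u + G * u * (m + u) := by ring
    rw [h1]
    linarith [hVt, hGu, hE1, hE2, hid]
  calc μ.real (F ∩ L) * Sc * u ≤ (X + G) * Sc * u :=
        mul_le_mul_of_nonneg_right (mul_le_mul_of_nonneg_right hcover (hnn _)) hu0
    _ ≤ V * t * u + 3 * δ := key

/-- **Removing the null separation event by scaling the weights.**  For every weight function: if `c ∈ A`, `|A| ≥ 3`,
`0 ≤ t`, `S(a) ≤ t` for `a ∈ A ∖ c` and `t ≤ S(c)`, then `μ(F ∩ L) · S(c) · h(c) ≤ μ(F ∩ {1 ≤ N} ∩ R_c) · t · h(c)`. -/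
theorem stcs_mul_of_continuity
    (hcont : ∀ (n : ℕ) (E : Set (BondConfig (Fin n))),
      Continuous fun w : Sym2 (Fin n) → unitInterval => (prodBernoulli w).real E)
    (w : Sym2 (Fin n) → unitInterval) (A : Finset (Fin n)) (o c : Fin n) (t : ℝ) (ht : 0 ≤ t) (hc : c ∈ A)
    (hk : 3 ≤ A.card)
    (hdom : ∀ a ∈ A.erase c,
      (prodBernoulli w).real {ω : BondConfig (Fin n) | (A.filter fun x => ω ∈ openConn a x).card ≤ A.card - 2} ≤ t)
    (htc : t ≤ (prodBernoulli w).real {ω : BondConfig (Fin n) | (A.filter fun x => ω ∈ openConn c x).card ≤ A.card - 2}) :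
    (prodBernoulli w).real ((openConn o c : Set (BondConfig (Fin n)))ᶜ ∩
          {ω | 1 ≤ (A.filter fun x => ω ∈ openConn o x).card ∧
            (A.filter fun x => ω ∈ openConn o x).card ≤ A.card - 2}) *
        (prodBernoulli w).real {ω : BondConfig (Fin n) | (A.filter fun x => ω ∈ openConn c x).card ≤ A.card - 2} *
        (prodBernoulli w).real ({ω : BondConfig (Fin n) | ∀ t ∈ A.erase c, ω ∉ openConn c t} ∩
          {ω | ∀ t ∈ (↑(A.erase c) : Set (Fin n)), ∀ t' ∈ (↑(A.erase c) : Set (Fin n)), ω ∈ openConn t t'}) ≤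
      (prodBernoulli w).real ((openConn o c : Set (BondConfig (Fin n)))ᶜ ∩
          {ω | 1 ≤ (A.filter fun x => ω ∈ openConn o x).card ∧
            (A.filter fun x => ω ∈ openConn c x).card ≤ A.card - 2}) * t *
        (prodBernoulli w).real ({ω : BondConfig (Fin n) | ∀ t ∈ A.erase c, ω ∉ openConn c t} ∩
          {ω | ∀ t ∈ (↑(A.erase c) : Set (Fin n)), ∀ t' ∈ (↑(A.erase c) : Set (Fin n)), ω ∈ openConn t t'}) := by
  set R : Fin n → Set (BondConfig (Fin n)) := fun a =>
    {ω | (A.filter fun x => ω ∈ openConn a x).card ≤ A.card - 2} with hR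
  set FL : Set (BondConfig (Fin n)) := (openConn o c : Set (BondConfig (Fin n)))ᶜ ∩
    {ω | 1 ≤ (A.filter fun x => ω ∈ openConn o x).card ∧
      (A.filter fun x => ω ∈ openConn o x).card ≤ A.card - 2} with hFL
  set FR : Set (BondConfig (Fin n)) := (openConn o c : Set (BondConfig (Fin n)))ᶜ ∩
    {ω | 1 ≤ (A.filter fun x => ω ∈ openConn o x).card ∧
      (A.filter fun x => ω ∈ openConn c x).card ≤ A.card - 2} with hFR
  set H : Set (BondConfig (Fin n)) := {ω : BondConfig (Fin n) | ∀ t ∈ A.erase c, ω ∉ openConn c t} ∩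
    {ω | ∀ t ∈ (↑(A.erase c) : Set (Fin n)), ∀ t' ∈ (↑(A.erase c) : Set (Fin n)), ω ∈ openConn t t'} with hH
  -- scaled weights `w_k = (1 - 1/(k+1)) • w`, all `< 1`, converging to `w`
  have hcmem : ∀ k : ℕ, ((1 : ℝ) - 1 / ((k : ℝ) + 1)) ∈ unitInterval := by
    intro k
    have hk' : (0 : ℝ) < (k : ℝ) + 1 := Nat.cast_add_one_pos k
    have h1 : 1 / ((k : ℝ) + 1) ≤ 1 := by
      rw [div_le_one hk']; linarith [(Nat.cast_nonneg k : (0 : ℝ) ≤ k)]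
    have h0 : 0 ≤ 1 / ((k : ℝ) + 1) := by positivity
    exact ⟨by linarith, by linarith⟩
  set wk : ℕ → Sym2 (Fin n) → unitInterval :=
    fun k e => ⟨(1 - 1 / ((k : ℝ) + 1)) * (w e : ℝ), unitInterval.mul_mem (hcmem k) (w e).2⟩
    with hwk_def
  have hwk_lt : ∀ k e, ((wk k e : unitInterval) : ℝ) < 1 := by
    intro k e
    have hk' : (0 : ℝ) < (k : ℝ) + 1 := Nat.cast_add_one_pos k
    have hc' : (1 : ℝ) - 1 / ((k : ℝ) + 1) < 1 := by
      have : 0 < 1 / ((k : ℝ) + 1) := by positivity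
      linarith
    calc ((wk k e : unitInterval) : ℝ) = (1 - 1 / ((k : ℝ) + 1)) * (w e : ℝ) := rfl
      _ ≤ (1 - 1 / ((k : ℝ) + 1)) := mul_le_of_le_one_right (hcmem k).1 (w e).2.2
      _ < 1 := hc'
  have hc_lim : Tendsto (fun k : ℕ => (1 : ℝ) - 1 / ((k : ℝ) + 1)) atTop (𝓝 1) := by
    simpa using tendsto_const_nhds.sub (tendsto_one_div_add_atTop_nhds_zero_nat (𝕜 := ℝ))
  have hwk_lim : Tendsto wk atTop (𝓝 w) := by
    refine tendsto_pi_nhds.2 fun e => ?_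
    rw [tendsto_subtype_rng]
    have h := hc_lim.mul_const (w e : ℝ)
    rw [one_mul] at h
    exact h
  have hlimE : ∀ E : Set (Set (Sym2 (Fin n))),
      Tendsto (fun k => (prodBernoulli (wk k)).real E) atTop (𝓝 ((prodBernoulli w).real E)) :=
    fun E => ((hcont n E).tendsto w).comp hwk_lim
  -- error terms `δ k = ∑_{a ∈ A} |S_k(a) - S(a)| → 0`
  set δ : ℕ → ℝ := fun k => ∑ a ∈ A, |(prodBernoulli (wk k)).real (R a) - (prodBernoulli w).real (R a)| with hδ_def
  have hδ0 : ∀ k, 0 ≤ δ k := fun k => Finset.sum_nonneg fun a _ => abs_nonneg _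
  have hδ_lim : Tendsto δ atTop (𝓝 0) := by
    have h : ∀ a ∈ A, Tendsto (fun k =>
        |(prodBernoulli (wk k)).real (R a) - (prodBernoulli w).real (R a)|) atTop (𝓝 0) := by
      intro a _
      simpa using (tendsto_sub_nhds_zero_iff.2 (hlimE (R a))).abs
    simpa [hδ_def] using tendsto_finsetSum A h
  have hδa : ∀ k, ∀ a ∈ A, |(prodBernoulli (wk k)).real (R a) - (prodBernoulli w).real (R a)| ≤ δ k := by
    intro k a ha
    exact Finset.single_le_sum (f := fun a => |(prodBernoulli (wk k)).real (R a) - (prodBernoulli w).real (R a)|)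
      (fun a _ => abs_nonneg _) ha
  -- the bound at each `k`, with deficiency `3 δ k`
  have hkb : ∀ k, (prodBernoulli (wk k)).real FL * (prodBernoulli (wk k)).real (R c) * (prodBernoulli (wk k)).real H ≤
      (prodBernoulli (wk k)).real FR * t * (prodBernoulli (wk k)).real H + 3 * δ k := by
    intro k
    refine stcs_of_pairSep_pos (wk k) A o c t (δ k) ht (hδ0 k) hc hk ?_ ?_
      (singleFinger_pairSep_real_pos (wk k) (hwk_lt k) _)
    · intro a ha
      have h1 := hdom a ha
      have h2 := (abs_sub_le_iff.1 (hδa k a (Finset.mem_of_mem_erase ha))).1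
      change (prodBernoulli (wk k)).real (R a) ≤ t + δ k
      change (prodBernoulli w).real (R a) ≤ t at h1
      linarith
    · have h3 := (abs_sub_le_iff.1 (hδa k c hc)).2
      change t ≤ (prodBernoulli (wk k)).real (R c) + δ k
      change t ≤ (prodBernoulli w).real (R c) at htc
      linarith
  -- pass to the limit
  have hlimL : Tendsto (fun k => (prodBernoulli (wk k)).real FL * (prodBernoulli (wk k)).real (R c) *
      (prodBernoulli (wk k)).real H) atTop
      (𝓝 ((prodBernoulli w).real FL * (prodBernoulli w).real (R c) * (prodBernoulli w).real H)) :=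
    ((hlimE _).mul (hlimE _)).mul (hlimE _)
  have hlimR : Tendsto (fun k => (prodBernoulli (wk k)).real FR * t * (prodBernoulli (wk k)).real H + 3 * δ k) atTop
      (𝓝 ((prodBernoulli w).real FR * t * (prodBernoulli w).real H)) := by
    simpa using (((hlimE FR).mul_const t).mul (hlimE H)).add (hδ_lim.const_mul 3)
  exact le_of_tendsto_of_tendsto' hlimL hlimR hkb

end TwoLevelPackingCardSubTwo

open TwoLevelPackingCardSubTwo in
/-- **THE SHARPENED GUARDED CAUCHY–SCHWARZ LAW STCS2 AT LEVEL `|A| − 2`** (all `|A| ≥ 3`, unconditional).  For bond percolation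
with arbitrary edge probabilities on `Fin n`, relays `A` with `|A| ≥ 3`, an observer `o`, a relay `c ∈ A` and a threshold
`t ≥ 0` with `S(a) ≤ t ≤ S(c)` for `a ∈ A ∖ c` (`S(v) = μ(|π(v)| ≤ |A|−2)`; e.g. `c` a champion and `t` the runner-up value):
  `μ({o ↮ c} ∩ {1 ≤ N ≤ |A|−2}) · S(c) ≤ μ({o ↮ c} ∩ {1 ≤ N} ∩ {|π(c)| ≤ |A|−2}) · t`
— the `j = |A| − 2` instance of the binder of `Theorems.noHeavyLowerTail_of_sharpTCS` (ttrl2's STCS2; T-class).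
[cite: KozmaNitzan2024, Lemmas 1–2 (pp. 5–6); VandenbergHaggstromKahn2005, Thms. 1.3, 1.5 (Thm. 2.1 at q = 1)] -/
theorem sharpTCS_card_sub_two (n : ℕ) (w : Sym2 (Fin n) → unitInterval) (A : Finset (Fin n)) (o c : Fin n)
    (hk : 3 ≤ A.card) (hc : c ∈ A) (t : ℝ) (ht : 0 ≤ t)
    (hdom : ∀ a ∈ A, a ≠ c →
      (prodBernoulli w).real {ω : BondConfig (Fin n) | (A.filter fun x => ω ∈ openConn a x).card ≤ A.card - 2} ≤ t)
    (htc : t ≤ (prodBernoulli w).real {ω : BondConfig (Fin n) | (A.filter fun x => ω ∈ openConn c x).card ≤ A.card - 2}) :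
    (prodBernoulli w).real ((openConn o c : Set (BondConfig (Fin n)))ᶜ ∩
          {ω | 1 ≤ (A.filter fun x => ω ∈ openConn o x).card ∧
            (A.filter fun x => ω ∈ openConn o x).card ≤ A.card - 2}) *
        (prodBernoulli w).real {ω : BondConfig (Fin n) | (A.filter fun x => ω ∈ openConn c x).card ≤ A.card - 2} ≤
      (prodBernoulli w).real ((openConn o c : Set (BondConfig (Fin n)))ᶜ ∩
          {ω | 1 ≤ (A.filter fun x => ω ∈ openConn o x).card ∧
            (A.filter fun x => ω ∈ openConn c x).card ≤ A.card - 2}) * t := by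
  set μ := prodBernoulli w with hμ
  set R : Fin n → Set (BondConfig (Fin n)) := fun a =>
    {ω | (A.filter fun x => ω ∈ openConn a x).card ≤ A.card - 2} with hR
  set D : Fin n → Set (BondConfig (Fin n)) := fun d => {ω | ∀ t ∈ A.erase d, ω ∉ openConn d t} with hD
  set Qc : Fin n → Set (BondConfig (Fin n)) :=
    fun d => {ω | ∀ t ∈ (↑(A.erase d) : Set (Fin n)), ∀ t' ∈ (↑(A.erase d) : Set (Fin n)), ω ∈ openConn t t'} with hQc
  set F : Set (BondConfig (Fin n)) := (openConn o c : Set (BondConfig (Fin n)))ᶜ with hF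
  set L : Set (BondConfig (Fin n)) := {ω | 1 ≤ (A.filter fun x => ω ∈ openConn o x).card ∧
    (A.filter fun x => ω ∈ openConn o x).card ≤ A.card - 2} with hL
  set V : Set (BondConfig (Fin n)) := {ω | 1 ≤ (A.filter fun x => ω ∈ openConn o x).card ∧
    (A.filter fun x => ω ∈ openConn c x).card ≤ A.card - 2} with hV
  have hnn : ∀ s : Set (BondConfig (Fin n)), 0 ≤ μ.real s := fun _ => measureReal_nonneg
  have hdom' : ∀ a ∈ A.erase c, μ.real (R a) ≤ t :=
    fun a ha => hdom a (Finset.mem_of_mem_erase ha) (Finset.mem_erase.1 ha).1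
  have hmul := stcs_mul_of_continuity stub_weightContinuity w A o c t ht hc hk hdom' htc
  set u := μ.real (D c ∩ Qc c) with hu
  rcases (hnn (D c ∩ Qc c)).eq_or_lt with hu0 | hupos
  · -- `h(c) = 0`: every `h(d) = 0`, so `t = S(c)` and the covering terms vanish
    have hne : (A.erase c).Nonempty := by
      rw [← Finset.card_pos, Finset.card_erase_of_mem hc]; omega
    obtain ⟨d₀, hd₀⟩ := hne
    have hSd : ∀ d ∈ A.erase c, μ.real (R d) = μ.real (R c) - u + μ.real (D d ∩ Qc d) :=
      fun d hd => light_split w A c hc hk hd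
    have hud0 : ∀ d ∈ A.erase c, μ.real (D d ∩ Qc d) = 0 := by
      intro d hd
      have h1 := hSd d hd
      have h2 := hdom' d hd
      have h3 : 0 ≤ μ.real (D d ∩ Qc d) := hnn _
      rw [hu, ← hu0] at h1
      linarith
    have htS : t = μ.real (R c) := by
      have h1 := hSd d₀ hd₀
      have h2 := hdom' d₀ hd₀
      rw [hu, ← hu0, hud0 d₀ hd₀] at h1
      linarith
    have hG0 : ∑ d ∈ A.erase c, μ.real (openConn o d ∩ D d ∩ Qc d) = 0 := by
      refine Finset.sum_eq_zero fun d hd => le_antisymm ?_ (hnn _)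
      calc μ.real (openConn o d ∩ D d ∩ Qc d) ≤ μ.real (D d ∩ Qc d) :=
            measureReal_mono (fun ω hω => ⟨hω.1.2, hω.2⟩) (measure_ne_top μ _)
        _ = 0 := hud0 d hd
    have hcov := cover_le w A o c hc
    have hX : μ.real (F ∩ L ∩ R c) ≤ μ.real (F ∩ V) :=
      measureReal_mono (fun ω hω => ⟨hω.1.1, hω.1.2.1, hω.2⟩) (measure_ne_top μ _)
    rw [htS]
    refine mul_le_mul_of_nonneg_right ?_ (hnn _)
    change μ.real (F ∩ L) ≤ μ.real (F ∩ L ∩ R c) + _ at hcov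
    rw [hG0, add_zero] at hcov
    exact hcov.trans hX
  · exact le_of_mul_le_mul_right hmul hupos

/-- **THE TWO-LEVEL PACKING QP AT LEVEL `|A| − 2`** (all `|A| ≥ 3`): under the hypotheses of `sharpTCS_card_sub_two`,
  `μ({o ↮ c} ∩ {1 ≤ N ≤ |A|−2}) · S(c) ≤ μ({o ↮ c} ∩ {|π(c)| ≤ |A|−2}) · t`
— the `j = |A| − 2` instance of the binder of `Theorems.noHeavyLowerTail_of_twoLevelPacking`
(via `SharpTCS.twoLevelPacking_of_sharpTCS`). [this work] -/
theorem twoLevelPacking_card_sub_two (n : ℕ) (w : Sym2 (Fin n) → unitInterval) (A : Finset (Fin n)) (o c : Fin n)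
    (hk : 3 ≤ A.card) (hc : c ∈ A) (t : ℝ) (ht : 0 ≤ t)
    (hdom : ∀ a ∈ A, a ≠ c →
      (prodBernoulli w).real {ω : BondConfig (Fin n) | (A.filter fun x => ω ∈ openConn a x).card ≤ A.card - 2} ≤ t)
    (htc : t ≤ (prodBernoulli w).real {ω : BondConfig (Fin n) | (A.filter fun x => ω ∈ openConn c x).card ≤ A.card - 2}) :
    (prodBernoulli w).real ((openConn o c : Set (BondConfig (Fin n)))ᶜ ∩
          {ω | 1 ≤ (A.filter fun x => ω ∈ openConn o x).card ∧
            (A.filter fun x => ω ∈ openConn o x).card ≤ A.card - 2}) *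
        (prodBernoulli w).real {ω : BondConfig (Fin n) | (A.filter fun x => ω ∈ openConn c x).card ≤ A.card - 2} ≤
      (prodBernoulli w).real ((openConn o c : Set (BondConfig (Fin n)))ᶜ ∩
          {ω | (A.filter fun x => ω ∈ openConn c x).card ≤ A.card - 2}) * t :=
  SharpTCS.twoLevelPacking_of_sharpTCS w A o c (A.card - 2) t ht
    (sharpTCS_card_sub_two n w A o c hk hc t ht hdom htc)

/-- **THE QUANTITATIVE GAP QG AT LEVEL `|A| − 2`** (all `|A| ≥ 3`): under the hypotheses of `sharpTCS_card_sub_two`,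
  `μ(1 ≤ N ≤ |A|−2) ≤ μ(o ↔ c)·S(c) + (1 − μ(o ↔ c))·t`
— "the cumulative isolation bound at level `|A| − 2` is strict off the tie ∪ glue locus by `(S(c) − t)·μ(o ↮ c)`"
(via `Theorems.quantGap_of_twoLevelPacking`). [this work] -/
theorem quantGap_card_sub_two (n : ℕ) (w : Sym2 (Fin n) → unitInterval) (A : Finset (Fin n)) (o c : Fin n)
    (hk : 3 ≤ A.card) (hc : c ∈ A) (t : ℝ) (ht : 0 ≤ t)
    (hdom : ∀ a ∈ A, a ≠ c →
      (prodBernoulli w).real {ω : BondConfig (Fin n) | (A.filter fun x => ω ∈ openConn a x).card ≤ A.card - 2} ≤ t)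
    (htc : t ≤ (prodBernoulli w).real {ω : BondConfig (Fin n) | (A.filter fun x => ω ∈ openConn c x).card ≤ A.card - 2}) :
    (prodBernoulli w).real {ω : BondConfig (Fin n) |
        1 ≤ (A.filter fun x => ω ∈ openConn o x).card ∧ (A.filter fun x => ω ∈ openConn o x).card ≤ A.card - 2} ≤
      (prodBernoulli w).real (openConn o c : Set (BondConfig (Fin n))) *
          (prodBernoulli w).real {ω : BondConfig (Fin n) | (A.filter fun x => ω ∈ openConn c x).card ≤ A.card - 2} +
        (1 - (prodBernoulli w).real (openConn o c : Set (BondConfig (Fin n)))) * t :=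
  quantGap_of_twoLevelPacking w A o c (A.card - 2) t ht hdom htc
    (twoLevelPacking_card_sub_two n w A o c hk hc t ht hdom htc)

end Summit.CriticalPhenomena.PercolationContinuityZ3.Theorems

end
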